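import Mathlib
import Literature.Computability.AlgebraicComplexity.GroupTheoreticMatMul
import Literature.Barriers.MatrixMultiplication.TricoloredSumFreeBarrier
import Summits.MatrixMultiplication.MatrixMultiplication.Theorems.AbelianSTPPCensusSieveRulesPacking

/-!
# Sieve rules for STPP families in finite abelian groups, II: stabiliser bookkeeping and U14-T divisibility

Support file for route `MatrixMultiplication/GroupTheoreticSTPP`, negative crux
`stmt-MatrixMultiplication-0596` (`CAbelianObstructionNeg`); cell mm-stpp, rung F-M1 (port of the planner's
HOME/mm-stpp-plan/PackingSketch.lean, sections Stabiliser and the core of MixedCoset).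

If a finset `S` is invariant under translation by every element of an additive subgroup `K`, then `|K|`
divides `|S|` (coset peeling, `card_filter_dvd_card_of_invariant`).  Applied to `S l = A l − B l + C l`
under tightness of U14 at `l`, with `K = ⟨C l − u₀⟩` (`diffClosure`), this gives the single clause of
U14-T: `∃ d, |C l| ≤ d ∧ d ∣ V l ∧ d ∣ |H|` (`exists_dvd_of_tight`, rotations `_bc`, `_ca`), and the core
lemma `closure_core_of_tight` used by the pair clauses of part III.

WHAT THIS IS NOT: no `ω` statement; necessary conditions only.
-/

-- single-conjunct summit: the mandated namespace repeats `MatrixMultiplication`.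
set_option linter.dupNamespace false

namespace Summit.MatrixMultiplication.MatrixMultiplication.Theorems

namespace STPPSieveRules

open Finset Literature.Computability.AlgebraicComplexity

variable {H : Type*} [AddCommGroup H] [DecidableEq H] {N : ℕ} {A B C : Fin N → Finset H}

/-! ### U14-T divisibility: the stabiliser bookkeeping, kernel form

If a finset `S` is invariant under translation by every element of an additive subgroup `K`, then
`|K|` divides `|S|` (coset peeling). Applied to `S l = A l − B l + C l` under tightness, with
`K = ⟨C l − u₀⟩`, this gives the single clause of U14-T: `∃ d, |C l| ≤ d ∧ d ∣ V l ∧ d ∣ |H|`. -/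

section Stabiliser

/-- Translating the carrier of `K` by an element of `K` gives the carrier back. [folklore] -/
theorem filter_mem_image_add_eq (K : AddSubgroup H) [DecidablePred (· ∈ K)] [Fintype H]
    {k : H} (hk : k ∈ K) :
    ((univ : Finset H).filter (· ∈ K)).image (· + k) = (univ : Finset H).filter (· ∈ K) := by
  ext y
  simp only [mem_image, mem_filter, mem_univ, true_and]
  constructor
  · rintro ⟨x, hx, rfl⟩
    exact K.add_mem hx hk
  · intro hy
    exact ⟨y - k, K.sub_mem hy hk, sub_add_cancel y k⟩

/-- Coset peeling: a `K`-invariant finset has cardinality divisible by `|K|`. -/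
theorem card_filter_dvd_card_of_invariant (K : AddSubgroup H) [DecidablePred (· ∈ K)] [Fintype H] :
    ∀ (n : ℕ) (S : Finset H), S.card ≤ n → (∀ k ∈ K, S.image (· + k) = S) →
      ((univ : Finset H).filter (· ∈ K)).card ∣ S.card := by
  intro n
  induction n with
  | zero =>
    intro S hS _
    rw [Nat.le_zero.mp hS]
    exact dvd_zero _
  | succ n ih =>
    intro S hS hinv
    rcases S.eq_empty_or_nonempty with rfl | ⟨s, hs⟩
    · simp
    · set Kf : Finset H := (univ : Finset H).filter (· ∈ K) with hKf
      set Cs : Finset H := Kf.image (· + s) with hCs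
      have hCsS : Cs ⊆ S := by
        intro x hx
        rw [hCs, mem_image] at hx
        obtain ⟨k, hk, rfl⟩ := hx
        rw [hKf, mem_filter] at hk
        rw [← hinv k hk.2, mem_image]
        exact ⟨s, hs, add_comm s k⟩
      have hCscard : Cs.card = Kf.card := card_image_of_injective _ (add_left_injective s)
      have hinv' : ∀ k ∈ K, (S \ Cs).image (· + k) = S \ Cs := by
        intro k hk
        rw [image_sdiff _ _ (add_left_injective k), hinv k hk]
        congr 1
        rw [hCs, image_image]
        have hcomm : ((fun x : H => x + k) ∘ (fun x : H => x + s)) =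
            (fun x : H => x + s) ∘ (fun x : H => x + k) := by
          funext x
          simp only [Function.comp]
          abel
        rw [hcomm, ← image_image, filter_mem_image_add_eq K hk]
      have hle : (S \ Cs).card ≤ n := by
        have h1 := card_sdiff_add_card_eq_card hCsS
        have hpos : 0 < Kf.card :=
          card_pos.mpr ⟨0, by rw [hKf, mem_filter]; exact ⟨mem_univ _, K.zero_mem⟩⟩
        omega
      have hd := ih (S \ Cs) hle hinv'
      rw [← card_sdiff_add_card_eq_card hCsS, hCscard]
      exact dvd_add hd (dvd_refl _)

/-- Invariance under a generating set extends to the generated subgroup. -/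
theorem image_add_eq_of_mem_closure (S : Finset H) (G : Set H)
    (hG : ∀ g ∈ G, S.image (· + g) = S) {k : H} (hk : k ∈ AddSubgroup.closure G) :
    S.image (· + k) = S := by
  induction hk using AddSubgroup.closure_induction with
  | mem x hx => exact hG x hx
  | zero => simp
  | add x y _ _ hx hy =>
    have hcomp : (fun z : H => z + (x + y)) = (fun z : H => z + y) ∘ (fun z : H => z + x) := by
      funext z
      simp only [Function.comp]
      abel
    rw [hcomp, ← image_image, hx, hy]
  | neg x _ hx =>
    have hcomp : (fun z : H => z) = (fun z : H => z + -x) ∘ (fun z : H => z + x) := by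
      funext z
      simp only [Function.comp]
      abel
    calc S.image (· + -x) = (S.image (· + x)).image (· + -x) := by rw [hx]
      _ = S.image (fun z => z) := by rw [image_image, ← hcomp]
      _ = S := image_id'

/-- `|K|` (as a filter of `univ`) divides `|H|`. [folklore] -/
theorem card_filter_dvd_card_univ (K : AddSubgroup H) [DecidablePred (· ∈ K)] [Fintype H] :
    ((univ : Finset H).filter (· ∈ K)).card ∣ Fintype.card H := by
  have huniv : ∀ k ∈ K, (univ : Finset H).image (· + k) = univ := fun k _ =>
    image_univ_of_surjective (fun y => ⟨y - k, sub_add_cancel y k⟩)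
  have := card_filter_dvd_card_of_invariant K _ (univ : Finset H) le_rfl huniv
  simpa using this

omit [DecidableEq H] in
/-- `Nat.card K` is the size of the filter of `univ` by membership in `K`. [folklore] -/
theorem natCard_eq_card_filter (K : AddSubgroup H) [DecidablePred (· ∈ K)] [Fintype H] :
    Nat.card K = ((univ : Finset H).filter (· ∈ K)).card := by
  rw [Nat.card_eq_fintype_card]
  convert Fintype.card_subtype (· ∈ K)

/-- Instance-free form of coset peeling: a `K`-invariant finset has size divisible by `Nat.card K`.
[folklore] -/
theorem natCard_dvd_card_of_invariant (K : AddSubgroup H) [Fintype H] (S : Finset H)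
    (hinv : ∀ k ∈ K, S.image (· + k) = S) : Nat.card K ∣ S.card := by
  classical
  rw [natCard_eq_card_filter]
  exact card_filter_dvd_card_of_invariant K _ S le_rfl hinv

/-- Lagrange: `Nat.card K ∣ |H|`. [folklore] -/
theorem natCard_dvd_card_univ' (K : AddSubgroup H) [Fintype H] : Nat.card K ∣ Fintype.card H := by
  classical
  rw [natCard_eq_card_filter]
  exact card_filter_dvd_card_univ K

omit [DecidableEq H] in
/-- A finset contained in `K` has at most `Nat.card K` elements. [folklore] -/
theorem card_le_natCard_of_subset (K : AddSubgroup H) [Fintype H] (T : Finset H)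
    (hT : ∀ x ∈ T, x ∈ K) : T.card ≤ Nat.card K := by
  classical
  rw [natCard_eq_card_filter]
  apply card_le_card
  intro x hx
  rw [mem_filter]
  exact ⟨mem_univ _, hT x hx⟩

/-- The subgroup generated by `C l − u₀`. -/
def diffClosure (T : Finset H) (u₀ : H) : AddSubgroup H :=
  AddSubgroup.closure (↑(T.image (fun u => u - u₀)) : Set H)

/-- `u − u₀ ∈ ⟨T − u₀⟩` for `u ∈ T`. [bookkeeping] -/
theorem sub_mem_diffClosure {T : Finset H} {u₀ u : H} (hu : u ∈ T) : u - u₀ ∈ diffClosure T u₀ :=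
  AddSubgroup.subset_closure (Finset.mem_coe.mpr (mem_image_of_mem _ hu))

/-- The three facts about `K = ⟨C l − u₀⟩` under ab-tightness at `l`:
`S l` is `K`-invariant, hence `|K| ∣ V l`; `|K| ∣ |H|`; `|C l| ≤ |K|`. -/
theorem diffClosure_facts_of_tight (h : IsSTPP A B C) [Fintype H] (l : Fin N)
    (hC : ∀ t, (C t).Nonempty)
    (htight : (A l).card * (B l).card * (C l).card + ∑ t ∈ univ.erase l, (A t).card * (B t).card
      = Fintype.card H) {u₀ : H} (hu₀ : u₀ ∈ C l) :
    (∀ k ∈ diffClosure (C l) u₀,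
        (((A l) ×ˢ (B l) ×ˢ (C l)).image sgnSum).image (· + k) = ((A l) ×ˢ (B l) ×ˢ (C l)).image sgnSum) ∧
      (C l).card ≤ Nat.card (diffClosure (C l) u₀) ∧
      Nat.card (diffClosure (C l) u₀) ∣ (A l).card * (B l).card * (C l).card ∧
      Nat.card (diffClosure (C l) u₀) ∣ Fintype.card H := by
  have hinv : ∀ k ∈ diffClosure (C l) u₀,
      (((A l) ×ˢ (B l) ×ˢ (C l)).image sgnSum).image (· + k) =
        ((A l) ×ˢ (B l) ×ˢ (C l)).image sgnSum := by
    intro k hk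
    refine image_add_eq_of_mem_closure _ _ ?_ hk
    intro x hx
    rw [Finset.mem_coe, mem_image] at hx
    obtain ⟨u, hu, rfl⟩ := hx
    exact sgnSum_image_add_sub_eq_of_tight h l hC htight hu hu₀
  refine ⟨hinv, ?_, ?_, natCard_dvd_card_univ' _⟩
  · calc (C l).card = ((C l).image (fun u => u - u₀)).card :=
          (card_image_of_injective _ (sub_left_injective)).symm
      _ ≤ _ := by
          apply card_le_natCard_of_subset
          intro x hx
          rw [mem_image] at hx
          obtain ⟨u, hu, rfl⟩ := hx
          exact sub_mem_diffClosure hu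
  · rw [← card_image_sgnSum h l]
    exact natCard_dvd_card_of_invariant _ _ hinv

/-- **U14-T, single clause, kernel form.** Under tightness of U14 (ab-rotation) at `l`, there is
`d` (the order of the subgroup generated by `C l − u₀`) with `|C l| ≤ d`, `d ∣ V l`, `d ∣ |H|`. -/
theorem exists_dvd_of_tight (h : IsSTPP A B C) [Fintype H] (l : Fin N)
    (hC : ∀ t, (C t).Nonempty)
    (htight : (A l).card * (B l).card * (C l).card + ∑ t ∈ univ.erase l, (A t).card * (B t).card
      = Fintype.card H) :
    ∃ d : ℕ, (C l).card ≤ d ∧ d ∣ (A l).card * (B l).card * (C l).card ∧ d ∣ Fintype.card H := by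
  obtain ⟨u₀, hu₀⟩ := hC l
  obtain ⟨-, hle, hdvdV, hdvdH⟩ := diffClosure_facts_of_tight h l hC htight hu₀
  exact ⟨_, hle, hdvdV, hdvdH⟩

/-- bc-rotation of the single clause (periods `A l − A l` on `A l + B l − C l`). -/
theorem exists_dvd_of_tight_bc (h : IsSTPP A B C) [Fintype H] (l : Fin N)
    (hA : ∀ t, (A t).Nonempty)
    (htight : (B l).card * (C l).card * (A l).card + ∑ t ∈ univ.erase l, (B t).card * (C t).card
      = Fintype.card H) :
    ∃ d : ℕ, (A l).card ≤ d ∧ d ∣ (B l).card * (C l).card * (A l).card ∧ d ∣ Fintype.card H :=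
  exists_dvd_of_tight h.rotate l hA htight

/-- ca-rotation of the single clause (periods `B l − B l` on `−A l + B l + C l`). -/
theorem exists_dvd_of_tight_ca (h : IsSTPP A B C) [Fintype H] (l : Fin N)
    (hB : ∀ t, (B t).Nonempty)
    (htight : (C l).card * (A l).card * (B l).card + ∑ t ∈ univ.erase l, (C t).card * (A t).card
      = Fintype.card H) :
    ∃ d : ℕ, (B l).card ≤ d ∧ d ∣ (C l).card * (A l).card * (B l).card ∧ d ∣ Fintype.card H :=
  exists_dvd_of_tight h.rotate.rotate l hB htight

end Stabiliser

/-! ### U14-T′ coset forcing, kernel form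

(c) If ab-U14 is tight at `l` and the only `d` with `d ∣ V l`, `d ∣ |H|`, `|C l| ≤ d` is `d = |C l|`,
then `C l` is a coset of the subgroup `⟨C l − u₀⟩` (of order `|C l|`).
(d) If all three members of triple `l` are cosets of subgroups, then `V l ∣ |H|`
(the subgroup `K_A + K_B + K_C` stabilises `S l` and contains a translate of it). -/


/-! ### U14-T′ mixed cases (one or two coset members at an ab-tight index), kernel form

With `K = ⟨G ∪ (C l − u₀)⟩` for extra generators `G` stabilising `S l`:
(P1) `A l` a coset ⇒ `∃ d, |A l|·|C l| ≤ d ∧ d ∣ V l ∧ d ∣ |H|`;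
(P2) `B l` a coset ⇒ `∃ d, |B l|·|C l| ≤ d ∧ d ∣ V l ∧ d ∣ |H|`;
(P3) `A l`, `B l` cosets ⇒ `V l ∣ |H|`.  The bc/ca versions follow by `isSTPP_rotate`. -/

section MixedCoset

/-- TPP(l): `(s,u) ↦ s + u` is injective on `A l × C l`. -/
theorem card_image_add_AC (h : IsSTPP A B C) (l : Fin N) (hB : (B l).Nonempty) :
    (((A l) ×ˢ (C l)).image (fun p : H × H => p.1 + p.2)).card = (A l).card * (C l).card := by
  obtain ⟨t, ht⟩ := hB
  rw [card_image_of_injOn, card_product]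
  rintro ⟨s₁, u₁⟩ h₁ ⟨s₂, u₂⟩ h₂ he
  simp only [coe_product, Set.mem_prod, mem_coe] at h₁ h₂
  simp only at he
  have key : (s₁ - s₂) + (t - t) + (u₁ - u₂) = 0 := by
    have : s₁ + u₁ - (s₂ + u₂) = 0 := by rw [he]; abel
    rw [← this]; abel
  obtain ⟨-, -, hs, -, hu⟩ := h l l l s₂ h₂.1 s₁ h₁.1 t ht t ht u₂ h₂.2 u₁ h₁.2 key
  simp [hs, hu]

/-- TPP(l): `(t,u) ↦ u − t` is injective on `B l × C l`. -/
theorem card_image_sub_BC (h : IsSTPP A B C) (l : Fin N) (hA : (A l).Nonempty) :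
    (((B l) ×ˢ (C l)).image (fun p : H × H => p.2 - p.1)).card = (B l).card * (C l).card := by
  obtain ⟨s, hs⟩ := hA
  rw [card_image_of_injOn, card_product]
  rintro ⟨t₁, u₁⟩ h₁ ⟨t₂, u₂⟩ h₂ he
  simp only [coe_product, Set.mem_prod, mem_coe] at h₁ h₂
  simp only at he
  have key : (s - s) + (t₂ - t₁) + (u₁ - u₂) = 0 := by
    have : u₁ - t₁ - (u₂ - t₂) = 0 := by rw [he]; abel
    rw [← this]; abel
  obtain ⟨-, -, -, ht, hu⟩ := h l l l s hs s hs t₁ h₁.1 t₂ h₂.1 u₂ h₂.2 u₁ h₁.2 key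
  simp [ht, hu]

/-- Core: under ab-tightness, the closure of `G ∪ (C l − u₀)` stabilises `S l` whenever each
extra generator in `G` does; hence its order divides `V l` and `|H|`. -/
theorem closure_core_of_tight (h : IsSTPP A B C) [Fintype H] (l : Fin N)
    (hC : ∀ t, (C t).Nonempty)
    (htight : (A l).card * (B l).card * (C l).card + ∑ t ∈ univ.erase l, (A t).card * (B t).card
      = Fintype.card H) {u₀ : H} (hu₀ : u₀ ∈ C l) (G : Set H)
    (hG : ∀ g ∈ G, (((A l) ×ˢ (B l) ×ˢ (C l)).image sgnSum).image (· + g) =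
      ((A l) ×ˢ (B l) ×ˢ (C l)).image sgnSum) :
    Nat.card (AddSubgroup.closure (G ∪ ↑((C l).image (fun u => u - u₀)))) ∣
        (A l).card * (B l).card * (C l).card ∧
      Nat.card (AddSubgroup.closure (G ∪ ↑((C l).image (fun u => u - u₀)))) ∣ Fintype.card H := by
  set S : Finset H := ((A l) ×ˢ (B l) ×ˢ (C l)).image sgnSum with hS
  have hgen : ∀ g ∈ (G ∪ ↑((C l).image (fun u => u - u₀))), S.image (· + g) = S := by
    intro g hg
    rcases hg with hg | hg
    · exact hG g hg
    · rw [Finset.mem_coe, mem_image] at hg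
      obtain ⟨u, hu, rfl⟩ := hg
      exact sgnSum_image_add_sub_eq_of_tight h l hC htight hu hu₀
  have hinv : ∀ k ∈ AddSubgroup.closure (G ∪ ↑((C l).image (fun u => u - u₀))),
      S.image (· + k) = S := fun k hk => image_add_eq_of_mem_closure S _ hgen hk
  refine ⟨?_, natCard_dvd_card_univ' _⟩
  rw [← card_image_sgnSum h l]
  exact natCard_dvd_card_of_invariant _ S hinv

end MixedCoset
end STPPSieveRules

end Summit.MatrixMultiplication.MatrixMultiplication.Theorems
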